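import Summits.PneNP.PneNP.Theorems.ChebyshevTracialDesignWhiteningData
import Summits.PneNP.PneNP.Theorems.ChebyshevTracialDesignTightEigenDecay
import Summits.PneNP.PneNP.Theorems.ChebyshevTracialDesignTracialProfilePolynomial
import HarnessLib

/-!
# Cell pnp-psdrank, route `ChebyshevTracialDesign`: the RELATIVE-LAYER-ENERGY CELL — the r-uniform domination criterion with the cut side's
# whitened OPERATOR-NORM LAYER ENERGIES as hypotheses (the consumer of a vector-valued Keevash–Lifshitz inequality; MEMO-19 §2(d) (★))

Harmonic backbone of the crux `TracialDecayExp20` (stmt-PneNP-19878), brick 87c (prover g16). Brick 87b-II (`…WellConditionedCell`) bounds the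
modes of brick 45b by the TRIVIAL energy of the whitened cut side, `Σ_U (A^{(2κ)}_U)² ⪯ Σ_U A_U² ⪯ I/(μ·C(n,t))`, which is why it needs
`λ_min` of BOTH means to be `≳ n^{−1/2}`. Here the same assembly is run with the layer energies as DATA: in basis-free form, the hypothesis
on the cut side `X` (slice sum `X̄_Σ = Σ_{|U|=t} X_U ≻ 0`, inverse `W`, layer matrices `P̃^{(2κ)}_U[a,b] = ((Wᵀ)^{t−2κ}p^{ab}_{2κ})(U)` of its
entrywise harmonic data `p`) is

  `(RLE_κ)   C(n,t)·Σ_{|U|=t} (P̃^{(2κ)}_U)ᵀ·W·P̃^{(2κ)}_U ⪯ e_κ·X̄_Σ`   (`1 ≤ κ ≤ D/2`)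

— the RELATIVE layer-`2κ` energy of `X` is at most `e_κ` (whitened: `Σ_U (Q̃^{(2κ)}_U)ᵀQ̃^{(2κ)}_U ⪯ (e_κ/C(n,t))·I`; trivially `e_κ = 1/μ` when
`X̄_Σ ⪰ μ·C(n,t)·I`; at `r = 1` it is `‖f_{2κ}‖²/μ² ≤ e_κ`, the quantity a level-`d` inequality bounds for global `f`). THEOREMS:
* **`virtualNonneg_of_relativeLayerEnergy`** — `n` even, `t = 2c'+1`, `2t ≤ n`, `D ≤ 2c'`; psd-contraction fields `X`, `Y` of ANY dimension with
  `X̄_Σ ≻ 0` (quantified as `X̄_Σ ⪰ μ·C(n,t)·I` for some `μ > 0`, which does NOT enter the condition), `Σ_M Y_M ⪰ ν·|PM|·I`, layer data `p` of `X`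
  satisfying `(RLE_κ)` with `e_κ ≥ 0`, and the condition `Σ_{κ=1}^{D/2} R_κ·√(A_κ·e_κ) ≤ √ν`: the virtual value (45b's form) is `≥ 0`.
* **`value_le_tail_of_relativeLayerEnergy`** — hence the design value of such a pair is `≤ r·(Σ_c|w_c|)·√P_{D/2+1}` for every exact design of
  degree `D ≤ 2c'` (brick 20) — for the layer data `p` that brick 20 provides, so the hypothesis is asked of every layer data of `X`.
READING (MEMO-19 §2(d)): with `A_κ = Π_{i<κ}(2i+1)/(n−2i) ≍ n^{−κ}`, the condition asks `e_1 ≲ ν·n`, `e_2 ≲ ν·n²`, … — so a cut side whose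
relative low-layer energies are `polylog` (what a VECTOR-valued Keevash–Lifshitz inequality would give for DIRECTIONALLY GLOBAL whitened fields)
is virtually nonnegative against every matching side of min-density `ν ≳ polylog/n`, at every `r`. That inequality (hypercontractivity for
global matrix/vector-valued functions on the slice, operator norm) is NOT in print as far as searched (MEMO-19 §5; nearest: Ben-Aroya–Regev–
de Wolf 2008 on the cube, arXiv:2109.02600); this file is its consumer, so that landing it (plus a directional Kupavskii–Zakharov decomposition)
closes the dense-cell step of an r-uniform proof.
[cite: BrouwerHaemers2012, Thm. 4.9.1 (PDF p. 93)] [cite: MacWilliamsSloane1977, Ch. 21 §6 Thm. 10 (PDF p. 516)] [cite: Grigoriev2001, Lemma 1.4 (PDF p. 8)]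
[cite: KeevashLifshitz2023, Thm. 1.8] [cite: GriblingDelaatLaurent2019, §5] [cite: Rothvoss2017, §2 (PDF p. 6)]
Stature: support/instrument (no defs, kernel lane; an unconditional theorem on a sub-class of strategies, with the layer energies as explicit
hypotheses). WHAT THIS IS NOT: no level-d inequality is proved here; not the crux; nothing on psd rank of P_PM(K_n); no P-vs-NP content.
Supports stmt-PneNP-19878.
-/

set_option linter.dupNamespace false -- `Summit.PneNP.PneNP.…`: summit = sub-problem (D-0017)

noncomputable section

namespace Summit.PneNP.PneNP.Theorems.ChebyshevTracialDesignRelativeLayerCell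

open Finset Matrix Literature.Barriers.PneNP Literature.Combinatorics.Optimization Literature.Computability.Complexity
open Literature.Combinatorics.AssociationSchemes Literature.Combinatorics.AssociationSchemes.JohnsonHarmonics
open Literature.Combinatorics.AssociationSchemes.JohnsonSpectrum
open Summit.PneNP.PneNP.Theorems.ChebyshevTracialDesignCommutative (posSemidef_conj one_sub_conj conj_mul_conj trace_conj)
open Summit.PneNP.PneNP.Theorems.ChebyshevTracialDesignWhitenedModeBound
open Summit.PneNP.PneNP.Theorems.ChebyshevTracialDesignWhiteningData
open Summit.PneNP.PneNP.Theorems.ChebyshevTracialDesignHSModeParseval (kernelEigen_tight_even_le)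
open Summit.PneNP.PneNP.Theorems.ChebyshevTracialDesignTightEigenDecay (kernelEigen_tight_even_nonneg)
open Summit.PneNP.PneNP.Theorems.ChebyshevTracialDesignTightFreeSpectral (exists_tightGram_classFunction)
open Summit.PneNP.PneNP.Theorems.ChebyshevTracialDesignVirtualBimodePsd (virtual_psd_mul_eq layerCorr_zero_weighted)
open Summit.PneNP.PneNP.Theorems.ChebyshevTracialDesignTracialProfilePolynomial (sum_oddSet_card_eq tracial_value_truncation_explicit)
open Summit.PneNP.PneNP.Theorems.ChebyshevTracialDesignProfilePolynomial (card_pmatch_pos)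

variable {n r : ℕ}

/-- **RELATIVE-LAYER-ENERGY CRITERION, AT EVERY DIMENSION.** With the relative layer energies `e_κ` of the cut side as hypotheses
(`C(n,t)·Σ_U (P̃^{(2κ)}_U)ᵀ W P̃^{(2κ)}_U ⪯ e_κ·X̄_Σ`, `W X̄_Σ = I`) and a matching side of min-density `ν`, the condition `Σ_κ R_κ√(A_κ e_κ) ≤ √ν`
forces the virtual value to be nonnegative. [cite: Grigoriev2001, Lemma 1.4 (PDF p. 8)] [cite: BrouwerHaemers2012, Thm. 4.9.1 (PDF p. 93)]
[cite: MacWilliamsSloane1977, Ch. 21 §6 Thm. 10 (PDF p. 516)] [cite: KeevashLifshitz2023, Thm. 1.8] -/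
theorem virtualNonneg_of_relativeLayerEnergy {c' D : ℕ} (hn : Even n) (ht : 2 * (2 * c' + 1) ≤ n) (hD : D ≤ 2 * c')
    (X : OddSet n → Matrix (Fin r) (Fin r) ℝ) (Y : PMatch n → Matrix (Fin r) (Fin r) ℝ)
    (hX : ∀ U, (X U).PosSemidef ∧ (1 - X U).PosSemidef) (hY : ∀ M, (Y M).PosSemidef ∧ (1 - Y M).PosSemidef)
    {μ ν : ℝ} (hμ : 0 < μ) (hν : 0 < ν)
    (hXbar : ((∑ U : OddSet n, if U.1.card = 2 * c' + 1 then X U else 0) -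
      (μ * (n.choose (2 * c' + 1) : ℝ)) • (1 : Matrix (Fin r) (Fin r) ℝ)).PosSemidef)
    (hYbar : ((∑ M, Y M) - (ν * (Fintype.card (PMatch n) : ℝ)) • (1 : Matrix (Fin r) (Fin r) ℝ)).PosSemidef)
    (W : Matrix (Fin r) (Fin r) ℝ) (hW : W * (∑ U : OddSet n, if U.1.card = 2 * c' + 1 then X U else 0) = 1)
    (p : Fin r × Fin r → ℕ → Finset (Fin n) → ℝ) (hp : ∀ ab j, IsHarmonic j (p ab j))
    (hpdec : ∀ ab (U : OddSet n), U.1.card = 2 * c' + 1 →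
      X U ab.1 ab.2 = (∑ j ∈ range (2 * c' + 1 + 1), up^[2 * c' + 1 - j] (p ab j)) U.1)
    (e : ℕ → ℝ) (he : ∀ κ, 0 ≤ e κ)
    (hXlayer : ∀ κ ∈ Icc 1 (D / 2), (e κ • (∑ U : OddSet n, if U.1.card = 2 * c' + 1 then X U else 0) -
      (n.choose (2 * c' + 1) : ℝ) • ∑ U ∈ univ.powersetCard (2 * c' + 1),
        (Matrix.of fun a b => (up^[2 * c' + 1 - 2 * κ] (p (a, b) (2 * κ))) U)ᵀ * W *
          (Matrix.of fun a b => (up^[2 * c' + 1 - 2 * κ] (p (a, b) (2 * κ))) U)).PosSemidef)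
    (hcond : ∑ κ ∈ Icc 1 (D / 2),
        (∏ i ∈ range κ, (((2 * c' + 1 : ℝ) - 2 * i) * ((n : ℝ) - 2 * c' - 1 - 2 * i) /
            (((2 * c' : ℝ) - 2 * i) * ((n : ℝ) - 2 * c' - 2 - 2 * i)))) *
          Real.sqrt ((∏ i ∈ range κ, ((2 * i + 1 : ℝ) / ((n : ℝ) - 2 * i))) * e κ) ≤ Real.sqrt ν) :
    0 ≤ ∑ M : PMatch n, ∑ A : {A : Finset (Fin n) // A.card ≤ D},
        (Matrix.of (fun a b : Fin r =>
          (∑ j ∈ range (2 * c' + 1 + 1), ((2 * c' + 1 - j).factorial : ℝ) • (if D < j then 0 else p (a, b) j)) A.1) * Y M).trace *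
          knapsackMoment M.1.card (((2 * c' + 1 : ℕ) : ℝ) / 2) (M.1.filter fun e => ∃ a ∈ A.1, a ∈ e).card := by
  -- constants
  have hPm : (0 : ℝ) < Fintype.card (PMatch n) := by exact_mod_cast card_pmatch_pos hn
  have hCn : (0 : ℝ) < (n.choose (2 * c' + 1) : ℝ) := by exact_mod_cast Nat.choose_pos (by omega)
  set Pm : ℝ := (Fintype.card (PMatch n) : ℝ) with hPmdef
  set Cn : ℝ := (n.choose (2 * c' + 1) : ℝ) with hCndef
  set N₁ : ℝ := ((((n / 2).choose (1 + c') * (1 + c').choose c' * 2 ^ 1 : ℕ) : ℝ)) with hN₁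
  have hN₁pos : 0 < N₁ := by
    rw [hN₁]
    have h1 : 0 < (n / 2).choose (1 + c') := Nat.choose_pos (by omega)
    have h2 : 0 < (1 + c').choose c' := Nat.choose_pos (by omega)
    exact_mod_cast Nat.mul_pos (Nat.mul_pos h1 h2) (by norm_num)
  set k : Finset (Fin n) → PMatch n → ℝ := fun U M => if (U.filter fun x => M.2.partner x ∉ U).card = 1 then (1 : ℝ) else 0 with hk
  set Cm : ℕ → ℝ := fun κ => ∑ ab : Fin r × Fin r, ∑ M : PMatch n, Y M ab.2 ab.1 * ∑ U ∈ univ.powersetCard (2 * c' + 1),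
    (up^[2 * c' + 1 - 2 * κ] (p ab (2 * κ))) U * k U M with hCm
  set R : ℕ → ℝ := fun κ => ∏ i ∈ range κ, (((2 * c' + 1 : ℝ) - 2 * i) * ((n : ℝ) - 2 * c' - 1 - 2 * i) /
    (((2 * c' : ℝ) - 2 * i) * ((n : ℝ) - 2 * c' - 2 - 2 * i))) with hR
  set Aκ : ℕ → ℝ := fun κ => ∏ i ∈ range κ, ((2 * i + 1 : ℝ) / ((n : ℝ) - 2 * i)) with hAκ
  set V : ℝ := ∑ M : PMatch n, ∑ A : {A : Finset (Fin n) // A.card ≤ D},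
        (Matrix.of (fun a b : Fin r =>
          (∑ j ∈ range (2 * c' + 1 + 1), ((2 * c' + 1 - j).factorial : ℝ) • (if D < j then 0 else p (a, b) j)) A.1) * Y M).trace *
          knapsackMoment M.1.card (((2 * c' + 1 : ℕ) : ℝ) / 2) (M.1.filter fun e => ∃ a ∈ A.1, a ∈ e).card with hV
  -- brick 45b: the virtual value in modes
  have h45 : V * N₁ = ∑ κ ∈ range (D / 2 + 1), R κ * Cm κ := virtual_psd_mul_eq hn ht hD p hp Y
  -- the cut side as a function on `t`-subsets
  set SX : Matrix (Fin r) (Fin r) ℝ := ∑ U : OddSet n, if U.1.card = 2 * c' + 1 then X U else 0 with hSX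
  set SY : Matrix (Fin r) (Fin r) ℝ := ∑ M, Y M with hSY
  set Xf : Finset (Fin n) → Matrix (Fin r) (Fin r) ℝ := fun U =>
    if h : U.card = 2 * c' + 1 then X ⟨U, by rw [h]; exact odd_two_mul_add_one c'⟩ else 0 with hXf
  have hXf_eq : ∀ U (hU : U.card = 2 * c' + 1), Xf U = X ⟨U, by rw [hU]; exact odd_two_mul_add_one c'⟩ := fun U hU => by
    rw [hXf]; exact dif_pos hU
  have hXf_psd : ∀ U ∈ univ.powersetCard (2 * c' + 1), (Xf U).PosSemidef ∧ (1 - Xf U).PosSemidef := fun U hU => by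
    rw [hXf_eq U (mem_powersetCard.1 hU).2]; exact hX _
  have hXfdec : ∀ ab, ∀ U ∈ univ.powersetCard (2 * c' + 1),
      Xf U ab.1 ab.2 = (∑ j ∈ range (2 * c' + 1 + 1), up^[2 * c' + 1 - j] (p ab j)) U := fun ab U hU => by
    rw [hXf_eq U (mem_powersetCard.1 hU).2]; exact hpdec ab _ (mem_powersetCard.1 hU).2
  have hSX_eq : SX = ∑ U ∈ univ.powersetCard (2 * c' + 1), Xf U := by
    ext a b
    rw [hSX, Matrix.sum_apply, Matrix.sum_apply]
    have h := sum_oddSet_card_eq (n := n) (odd_two_mul_add_one c') (fun U => Xf U a b)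
    rw [← h]
    refine sum_congr rfl fun U _ => ?_
    split_ifs with hU
    · rw [hXf_eq U.1 hU]
    · rfl
  -- whitening
  have hSXherm : SX.IsHermitian := by
    rw [hSX_eq]
    unfold IsHermitian
    rw [conjTranspose_sum]
    exact sum_congr rfl fun U hU => (hXf_psd U hU).1.1
  have hSYherm : SY.IsHermitian := by
    rw [hSY]
    unfold IsHermitian
    rw [conjTranspose_sum]
    exact sum_congr rfl fun M _ => (hY M).1.1
  have hXbar' : (SX - (μ * Cn) • (1 : Matrix (Fin r) (Fin r) ℝ)).PosSemidef := hXbar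
  obtain ⟨S, S', hSS', hSSt, hS'X, -⟩ := exists_whitening hSXherm (mul_pos hμ hCn) hXbar'
  obtain ⟨T, T', hTT', hTTt, hT'Y, hT'le⟩ := exists_whitening hSYherm (mul_pos hν hPm) hYbar
  set C : Matrix (Fin r) (Fin r) ℝ := Sᵀ * T with hCdef
  have htrC : (Cᵀ * C).trace = (SX * SY).trace := by rw [hCdef, trace_whiten_overlap, hSSt, hTTt]
  have htr0 : 0 ≤ (Cᵀ * C).trace := by
    rw [← sum_sq_eq_trace_transpose_mul]; exact sum_nonneg fun il _ => sq_nonneg _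
  -- whitened sides
  set Bw : PMatch n → Matrix (Fin r) (Fin r) ℝ := fun M => T' * Y M * T'ᵀ with hBw
  set q : Fin r × Fin r → ℕ → Finset (Fin n) → ℝ := fun ab j => ∑ c, ∑ d, (S' ab.1 c * S' ab.2 d) • p (c, d) j with hq
  have hqh : ∀ ab j, IsHarmonic j (q ab j) := fun ab j =>
    IsHarmonic.sum _ fun c _ => IsHarmonic.sum _ fun d _ => (hp (c, d) j).smul _
  -- energy of the whitened matching side: `Σ Bw² ⪯ (ν Pm)⁻¹ I`
  have hBw_sum : ∑ M, Bw M = 1 := by rw [← hT'Y, hSY, Finset.mul_sum, Finset.sum_mul]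
  have hBwE : ((ν * Pm)⁻¹ • (1 : Matrix (Fin r) (Fin r) ℝ) - ∑ M, (Bw M)ᵀ * Bw M).PosSemidef := by
    have h := sum_sq_le_of_contraction_family (univ : Finset (PMatch n)) Bw
      (fun M _ => posSemidef_conj (hY M).1 T') (K := (ν * Pm)⁻¹) (N := 1) (inv_nonneg.2 (mul_pos hν hPm).le)
      (fun M _ => by
        have h1 : ((ν * Pm)⁻¹ • (1 : Matrix (Fin r) (Fin r) ℝ) - T' * Y M * T'ᵀ) =
            ((ν * Pm)⁻¹ • (1 : Matrix (Fin r) (Fin r) ℝ) - T' * T'ᵀ) + T' * (1 - Y M) * T'ᵀ := by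
          rw [Matrix.mul_sub, Matrix.sub_mul, Matrix.mul_one]; abel
        rw [hBw]; dsimp only; rw [h1]
        exact hT'le.add (posSemidef_conj (hY M).2 T'))
      (by rw [hBw_sum, one_smul, sub_self]; exact PosSemidef.zero)
    rwa [mul_one] at h
  -- the tight Gram class function
  obtain ⟨κ₁, hA1⟩ := exists_tightGram_classFunction (n := n) (odd_two_mul_add_one c')
  -- each mode in whitened form, and its bound
  have hmode : ∀ κ ∈ Icc 1 (D / 2), |Cm κ| ≤ (N₁ / Cn) * (Real.sqrt (Aκ κ * e κ) / Real.sqrt ν) * (SX * SY).trace := by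
    intro κ hκI
    have hκ : κ ≤ c' := by have := (mem_Icc.1 hκI).2; omega
    have hjt : 2 * κ ≤ 2 * c' + 1 := by omega
    -- rewrite the mode
    set Qt : Finset (Fin n) → Matrix (Fin r) (Fin r) ℝ := fun U => Matrix.of fun a b => (up^[2 * c' + 1 - 2 * κ] (q (a, b) (2 * κ))) U
      with hQt
    set Pt : Finset (Fin n) → Matrix (Fin r) (Fin r) ℝ := fun U => Matrix.of fun a b => (up^[2 * c' + 1 - 2 * κ] (p (a, b) (2 * κ))) U
      with hPt
    have hQP : ∀ U, Qt U = S' * Pt U * S'ᵀ := fun U => by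
      rw [hPt, hQt]; dsimp only; rw [conj_layerMatrix S' (fun a b => p (a, b) (2 * κ)) U]
    have hSQS : ∀ U, S * Qt U * Sᵀ = Pt U := fun U => by
      rw [hQP U]
      calc S * (S' * Pt U * S'ᵀ) * Sᵀ = (S * S') * Pt U * (S * S')ᵀ := by rw [transpose_mul]; simp only [Matrix.mul_assoc]
        _ = Pt U := by rw [hSS', transpose_one, Matrix.one_mul, Matrix.mul_one]
    have hTBT : ∀ M, T * Bw M * Tᵀ = Y M := fun M => by
      rw [hBw]; dsimp only
      calc T * (T' * Y M * T'ᵀ) * Tᵀ = (T * T') * Y M * (T * T')ᵀ := by rw [transpose_mul]; simp only [Matrix.mul_assoc]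
        _ = Y M := by rw [hTT', transpose_one, Matrix.one_mul, Matrix.mul_one]
    have hCm_eq : Cm κ = ∑ U ∈ univ.powersetCard (2 * c' + 1), ∑ M : PMatch n, k U M * (Qt U * C * Bw M * Cᵀ).trace := by
      have e1 : ∀ U (M : PMatch n), (Qt U * C * Bw M * Cᵀ).trace = (Pt U * Y M).trace := fun U M => by
        rw [← hSQS U, ← hTBT M, hCdef, trace_dewhiten]
      simp_rw [e1, Summit.PneNP.PneNP.Theorems.ChebyshevTracialDesignTracialProfilePolynomial.trace_mul_eq_sum_pairs, mul_sum]
      rw [hCm]; dsimp only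
      calc ∑ ab : Fin r × Fin r, ∑ M : PMatch n, Y M ab.2 ab.1 * ∑ U ∈ univ.powersetCard (2 * c' + 1),
            (up^[2 * c' + 1 - 2 * κ] (p ab (2 * κ))) U * k U M
          = ∑ ab : Fin r × Fin r, ∑ M : PMatch n, ∑ U ∈ univ.powersetCard (2 * c' + 1),
              k U M * (Pt U ab.1 ab.2 * Y M ab.2 ab.1) := by
            refine sum_congr rfl fun ab _ => sum_congr rfl fun M _ => ?_
            rw [mul_sum]
            refine sum_congr rfl fun U _ => ?_
            rw [hPt]; dsimp only; rw [Matrix.of_apply]; ring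
        _ = ∑ ab : Fin r × Fin r, ∑ U ∈ univ.powersetCard (2 * c' + 1), ∑ M : PMatch n,
              k U M * (Pt U ab.1 ab.2 * Y M ab.2 ab.1) := sum_congr rfl fun ab _ => sum_comm
        _ = ∑ U ∈ univ.powersetCard (2 * c' + 1), ∑ ab : Fin r × Fin r, ∑ M : PMatch n,
              k U M * (Pt U ab.1 ab.2 * Y M ab.2 ab.1) := sum_comm
        _ = _ := sum_congr rfl fun U _ => sum_comm
    -- the whitened HS-mode bound
    have hΛ := kernelEigen_tight_even_nonneg hn ht hκ κ₁ hA1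
    -- the relative layer energy hypothesis, whitened: `Σ Q̃ᵀQ̃ ⪯ (e/Cn)·I`
    have hW' : W = S'ᵀ * S' := by
      have hS'S : S' * S = 1 := mul_eq_one_comm.1 hSS'
      have h1 : S'ᵀ * S' * SX = 1 := by
        rw [← hSSt]
        calc S'ᵀ * S' * (S * Sᵀ) = S'ᵀ * (S' * S) * Sᵀ := by simp only [Matrix.mul_assoc]
          _ = 1 := by rw [hS'S, Matrix.mul_one, ← transpose_mul, hSS', transpose_one]
      have h2 : SX * W = 1 := mul_eq_one_comm.1 hW
      calc W = (S'ᵀ * S' * SX) * W := by rw [h1, Matrix.one_mul]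
        _ = S'ᵀ * S' := by rw [Matrix.mul_assoc, h2, Matrix.mul_one]
    have hlayer : ((e κ / Cn) • (1 : Matrix (Fin r) (Fin r) ℝ) -
        ∑ U ∈ univ.powersetCard (2 * c' + 1), (Qt U)ᵀ * Qt U).PosSemidef := by
      have h0 := posSemidef_conj (hXlayer κ hκI) S'
      have e1 : S' * (e κ • SX - Cn • ∑ U ∈ univ.powersetCard (2 * c' + 1), (Pt U)ᵀ * W * Pt U) * S'ᵀ =
          e κ • (1 : Matrix (Fin r) (Fin r) ℝ) - Cn • ∑ U ∈ univ.powersetCard (2 * c' + 1), (Qt U)ᵀ * Qt U := by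
        rw [Matrix.mul_sub, Matrix.sub_mul, Matrix.mul_smul, Matrix.smul_mul, hS'X, Matrix.mul_smul, Matrix.smul_mul,
          Finset.mul_sum, Finset.sum_mul]
        congr 2
        refine sum_congr rfl fun U _ => ?_
        rw [hQP U, hW', transpose_mul, transpose_mul, transpose_transpose]
        simp only [Matrix.mul_assoc]
      have h1 : (e κ • (1 : Matrix (Fin r) (Fin r) ℝ) - Cn • ∑ U ∈ univ.powersetCard (2 * c' + 1), (Qt U)ᵀ * Qt U).PosSemidef := by
        have h0' := h0
        rw [show (fun U => (Matrix.of fun a b => (up^[2 * c' + 1 - 2 * κ] (p (a, b) (2 * κ))) U)ᵀ * W *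
            (Matrix.of fun a b => (up^[2 * c' + 1 - 2 * κ] (p (a, b) (2 * κ))) U)) = fun U => (Pt U)ᵀ * W * Pt U from rfl] at h0'
        rw [e1] at h0'
        exact h0'
      have h2 := h1.smul (inv_nonneg.2 hCn.le)
      rw [smul_sub, smul_smul, smul_smul, inv_mul_cancel₀ hCn.ne', one_smul, ← div_eq_inv_mul] at h2
      exact h2
    have hsq := whitened_HSmode_sq_le hjt (fun ab => q ab (2 * κ)) (fun ab => hqh ab (2 * κ)) κ₁ hA1 hΛ Bw C hlayer hBwE
    rw [← hCm_eq] at hsq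
    -- numeric bound on `λ α β`
    have hlam := kernelEigen_tight_even_le hn ht hκ κ₁ hA1
    have hAκ0 : 0 ≤ Aκ κ := by
      rw [hAκ]
      refine prod_nonneg fun i hi => ?_
      have hi' := mem_range.1 hi
      have : (2 * i : ℝ) + 2 ≤ n := by exact_mod_cast (show 2 * i + 2 ≤ n by omega)
      exact div_nonneg (by positivity) (by linarith)
    have hprod : kernelEigen n (2 * c' + 1) (2 * κ) κ₁ * (e κ / Cn) * (ν * Pm)⁻¹ ≤ (N₁ / Cn) ^ 2 * (Aκ κ * e κ / ν) := by
      have h1 : kernelEigen n (2 * c' + 1) (2 * κ) κ₁ * (e κ / Cn) * (ν * Pm)⁻¹ ≤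
          (Pm * N₁ ^ 2 / Cn * Aκ κ) * (e κ / Cn) * (ν * Pm)⁻¹ :=
        mul_le_mul_of_nonneg_right (mul_le_mul_of_nonneg_right hlam (div_nonneg (he κ) hCn.le))
          (inv_nonneg.2 (mul_pos hν hPm).le)
      refine h1.trans_eq ?_
      field_simp
    have habs : |Cm κ| ≤ Real.sqrt ((N₁ / Cn) ^ 2 * (Aκ κ * e κ / ν)) * (Cᵀ * C).trace := by
      have h1 : (Cm κ) ^ 2 ≤ ((N₁ / Cn) ^ 2 * (Aκ κ * e κ / ν)) * (Cᵀ * C).trace ^ 2 :=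
        hsq.trans (mul_le_mul_of_nonneg_right hprod (sq_nonneg _))
      have h2 := Real.abs_le_sqrt h1
      rwa [Real.sqrt_mul' _ (sq_nonneg _), Real.sqrt_sq htr0] at h2
    rw [Real.sqrt_mul (sq_nonneg _), Real.sqrt_sq (div_nonneg hN₁pos.le hCn.le), Real.sqrt_div' _ hν.le, htrC] at habs
    exact habs
  -- the overlap term `κ = 0`
  have hCm0 : Cm 0 = (N₁ / Cn) * (SX * SY).trace := by
    have e1 : ∀ ab : Fin r × Fin r, ∑ M : PMatch n, Y M ab.2 ab.1 * ∑ U ∈ univ.powersetCard (2 * c' + 1),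
        (up^[2 * c' + 1 - 2 * 0] (p ab (2 * 0))) U * k U M =
        (((2 * c' + 1).factorial : ℝ) * p ab (2 * 0) ∅ * N₁) * ∑ M : PMatch n, Y M ab.2 ab.1 := fun ab =>
      layerCorr_zero_weighted (c' := c') (by simpa using hp ab (2 * 0)) (fun M => Y M ab.2 ab.1)
    have e2 : ∀ ab : Fin r × Fin r, ((2 * c' + 1).factorial : ℝ) * p ab (2 * 0) ∅ = SX ab.1 ab.2 / Cn := by
      intro ab
      rw [Nat.mul_zero, eq_div_iff hCn.ne', hSX_eq, Matrix.sum_apply, sum_powersetCard_eq_of_layers Xf p hp hXfdec ab]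
      ring
    have e3 : ∀ ab : Fin r × Fin r, ∑ M : PMatch n, Y M ab.2 ab.1 = SY ab.2 ab.1 := fun ab => by rw [hSY, Matrix.sum_apply]
    rw [hCm]; dsimp only
    simp_rw [e1, e2, e3]
    rw [Summit.PneNP.PneNP.Theorems.ChebyshevTracialDesignTracialProfilePolynomial.trace_mul_eq_sum_pairs, mul_sum]
    exact sum_congr rfl fun ab _ => by ring
  -- assembly
  have htrXY : 0 ≤ (SX * SY).trace := by rw [← htrC]; exact htr0
  have hmain : 0 ≤ V * N₁ := by
    rw [h45, sum_range_succ_eq_add_Icc]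
    have hR0 : R 0 = 1 := by rw [hR]; exact prod_range_zero _
    rw [hR0, one_mul, hCm0]
    -- the modes `κ ≥ 1`
    have hsum : |∑ κ ∈ Icc 1 (D / 2), R κ * Cm κ| ≤
        (N₁ / Cn) * (SX * SY).trace * ((∑ κ ∈ Icc 1 (D / 2), R κ * Real.sqrt (Aκ κ * e κ)) / Real.sqrt ν) := by
      calc |∑ κ ∈ Icc 1 (D / 2), R κ * Cm κ| ≤ ∑ κ ∈ Icc 1 (D / 2), |R κ * Cm κ| := abs_sum_le_sum_abs _ _
        _ ≤ ∑ κ ∈ Icc 1 (D / 2), R κ * ((N₁ / Cn) * (Real.sqrt (Aκ κ * e κ) / Real.sqrt ν) * (SX * SY).trace) := by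
            refine sum_le_sum fun κ hκ => ?_
            have hκc : κ ≤ c' := by have := (mem_Icc.1 hκ).2; omega
            rw [abs_mul, abs_of_nonneg (layerRatio_nonneg ht hκc)]
            exact mul_le_mul_of_nonneg_left (hmode κ hκ) (layerRatio_nonneg ht hκc)
        _ = ∑ κ ∈ Icc 1 (D / 2), ((N₁ / Cn) * (SX * SY).trace) * (R κ * Real.sqrt (Aκ κ * e κ) / Real.sqrt ν) :=
            sum_congr rfl fun κ _ => by ring
        _ = (N₁ / Cn) * (SX * SY).trace * ((∑ κ ∈ Icc 1 (D / 2), R κ * Real.sqrt (Aκ κ * e κ)) / Real.sqrt ν) := by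
            rw [← Finset.mul_sum, Finset.sum_div]
    have hfrac : (∑ κ ∈ Icc 1 (D / 2), R κ * Real.sqrt (Aκ κ * e κ)) / Real.sqrt ν ≤ 1 := by
      rw [div_le_one (Real.sqrt_pos.2 hν)]
      exact hcond
    have hpos : 0 ≤ (N₁ / Cn) * (SX * SY).trace := mul_nonneg (div_nonneg hN₁pos.le hCn.le) htrXY
    have h1 := (abs_le.1 hsum).1
    nlinarith [mul_le_mul_of_nonneg_left hfrac hpos]
  -- divide by `N₁ > 0`
  exact le_of_mul_le_mul_right (by rwa [zero_mul]) hN₁pos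


/-- **Design value of a relative-layer-energy pair is at most the deep tail, at every dimension** (hypothesis `(RLE_κ)` asked of every layer
data of `X`; brick 20 supplies one). [cite: Rothvoss2017, §2 (PDF p. 6)] [cite: Grigoriev2001, Lemma 1.4 (PDF p. 8)] [cite: GriblingDelaatLaurent2019, §5]
[cite: CoppersmithRivlin1992, Thm. (p. 970)] -/
theorem value_le_tail_of_relativeLayerEnergy {c' T D : ℕ} {Bv : ℝ} {C : Finset ℕ} {w : ℕ → ℝ} (hn : Even n)
    (hdes : IsExactDesign n (2 * c' + 1) T D Bv C w) (hD : D ≤ 2 * c')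
    (X : OddSet n → Matrix (Fin r) (Fin r) ℝ) (Y : PMatch n → Matrix (Fin r) (Fin r) ℝ)
    (hX : ∀ U, (X U).PosSemidef ∧ (1 - X U).PosSemidef) (hY : ∀ M, (Y M).PosSemidef ∧ (1 - Y M).PosSemidef)
    {μ ν : ℝ} (hμ : 0 < μ) (hν : 0 < ν)
    (hXbar : ((∑ U : OddSet n, if U.1.card = 2 * c' + 1 then X U else 0) -
      (μ * (n.choose (2 * c' + 1) : ℝ)) • (1 : Matrix (Fin r) (Fin r) ℝ)).PosSemidef)
    (hYbar : ((∑ M, Y M) - (ν * (Fintype.card (PMatch n) : ℝ)) • (1 : Matrix (Fin r) (Fin r) ℝ)).PosSemidef)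
    (W : Matrix (Fin r) (Fin r) ℝ) (hW : W * (∑ U : OddSet n, if U.1.card = 2 * c' + 1 then X U else 0) = 1)
    (e : ℕ → ℝ) (he : ∀ κ, 0 ≤ e κ)
    (hXlayer : ∀ p : Fin r × Fin r → ℕ → Finset (Fin n) → ℝ, (∀ ab j, IsHarmonic j (p ab j)) →
      (∀ ab (U : OddSet n), U.1.card = 2 * c' + 1 →
        X U ab.1 ab.2 = (∑ j ∈ range (2 * c' + 1 + 1), up^[2 * c' + 1 - j] (p ab j)) U.1) →
      ∀ κ ∈ Icc 1 (D / 2), (e κ • (∑ U : OddSet n, if U.1.card = 2 * c' + 1 then X U else 0) -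
        (n.choose (2 * c' + 1) : ℝ) • ∑ U ∈ univ.powersetCard (2 * c' + 1),
          (Matrix.of fun a b => (up^[2 * c' + 1 - 2 * κ] (p (a, b) (2 * κ))) U)ᵀ * W *
            (Matrix.of fun a b => (up^[2 * c' + 1 - 2 * κ] (p (a, b) (2 * κ))) U)).PosSemidef)
    (hcond : ∑ κ ∈ Icc 1 (D / 2),
        (∏ i ∈ range κ, (((2 * c' + 1 : ℝ) - 2 * i) * ((n : ℝ) - 2 * c' - 1 - 2 * i) /
            (((2 * c' : ℝ) - 2 * i) * ((n : ℝ) - 2 * c' - 2 - 2 * i)))) *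
          Real.sqrt ((∏ i ∈ range κ, ((2 * i + 1 : ℝ) / ((n : ℝ) - 2 * i))) * e κ) ≤ Real.sqrt ν) :
    ∑ U : OddSet n, ∑ M : PMatch n, levelWeight n (2 * c' + 1) C w U M * (X U * Y M).trace ≤
      (r : ℝ) * ((∑ c ∈ C, |w c|) * Real.sqrt (∏ i ∈ range (D / 2 + 1), ((2 * i + 1 : ℝ) / ((n : ℝ) - 2 * i)))) := by
  have ht : 2 * (2 * c' + 1) ≤ n := by have := hdes.2.1; omega
  have hPm : (0 : ℝ) < Fintype.card (PMatch n) := by exact_mod_cast card_pmatch_pos hn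
  have hCn : (0 : ℝ) < (n.choose (2 * c' + 1) : ℝ) := by exact_mod_cast Nat.choose_pos (by omega)
  obtain ⟨p, hp, hpdec, habs⟩ := tracial_value_truncation_explicit hn hdes hD X Y
  have hV := virtualNonneg_of_relativeLayerEnergy hn ht hD X Y hX hY hμ hν hXbar hYbar W hW p hp hpdec e he (hXlayer p hp hpdec) hcond
  have h1 := (abs_le.1 habs).2
  have hPD : 0 ≤ ∏ i ∈ range (D / 2 + 1), ((2 * i + 1 : ℝ) / ((n : ℝ) - 2 * i)) := by
    refine prod_nonneg fun i hi => ?_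
    have hi' := mem_range.1 hi
    have : (2 * i : ℝ) + 2 ≤ n := by exact_mod_cast (show 2 * i + 2 ≤ n by omega)
    exact div_nonneg (by positivity) (by linarith)
  have htail := Summit.PneNP.PneNP.Theorems.ChebyshevTracialDesignTracialProfilePolynomial.sqrt_tail_le_of_le hPD hCn hPm
    (Nat.cast_nonneg r) (sum_nonneg fun M _ => sum_nonneg fun a _ => sum_nonneg fun b _ => sq_nonneg _)
    (Summit.PneNP.PneNP.Theorems.ChebyshevTracialDesignTracialProfilePolynomial.sum_frobenius_cuts_le hdes.1 hX)
    (Summit.PneNP.PneNP.Theorems.ChebyshevTracialDesignTracialProfilePolynomial.sum_frobenius_matchings_le hY)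
  have hBv : 0 ≤ ∑ c ∈ C, |w c| := sum_nonneg fun c _ => abs_nonneg _
  have h2 := mul_le_mul_of_nonneg_left htail hBv
  have h3 : 0 ≤ (Fintype.card (PMatch n) : ℝ)⁻¹ * _ := mul_nonneg (inv_nonneg.2 hPm.le) hV
  nlinarith [h1, h2, h3]

end Summit.PneNP.PneNP.Theorems.ChebyshevTracialDesignRelativeLayerCell

end
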